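import Literature.Probability.Percolation.TriOneBlockPatterns
import HarnessLib

/-!
# The sandpile class, I: site sets and their one-block ring patterns («SANDPILE-ONEBLOCK»)

Topic `Literature/Probability/Percolation`; family `crit-perc` / marked-loop lineage; a rider on `TriOneBlockPatterns.lean` («CYCLIC-BLOCK-CRITERIA»: `OneBlockAt` from two local
implications per site type). First half of (G0a) «SANDPILE-SITES» of HOME `pub-sawmu-b-engine-2/gen23/DESIGN-next-gen23.md` §2: the SITE SETS of the tame family of the
BSPAN programme (HOME `FINDING-BSPAN-SLIDE-INDUCTION.md` §3–§4) and the fact that they have ONE-BLOCK RING PATTERNS at every site of the plane — the local hypothesis of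
`TriMarkedDomain.ofOneBlock` (tree, `TriOneBlock.lean`; Bollobás–Riordan's «neither `G` nor `∂⁺(G)` has a cut-vertex», Ch. 7 §7.2.2 p. 168). Connectivity and co-connectivity
(the other two hypotheses of `ofOneBlock`) are NOT in this file.

* `baseStrip L` — the two-row base `{(x, y) : 0 ≤ x < L, y ∈ {0, 1}}` (`mem_baseStrip`); `IsPile L P` — a finite set `P` of cells hanging below it: every cell has height `< 0` and
  its two SUPPORTERS `c + e₁ = (x, y+1)`, `c + e₂ = (x−1, y+1)` in `baseStrip L ∪ P` (`triDir`: `e₀ = (1,0)`, `e₁ = (0,1)`, `e₂ = (−1,1)`, `e₃ = (−1,0)`, `e₄ = (0,−1)`, `e₅ = (1,−1)`);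
  `sandpile L P := baseStrip L ∪ P`;
* the support calculus: `mem_of_add_four_mem` / `mem_of_add_five_mem` (nothing hangs from a site outside the set), `add_one_mem_of_add_zero_mem` / `add_two_mem_of_add_three_mem`
  (below height `0` a neighbour to the right/left forces the common upper neighbour), `add_three_mem_of_add_four_mem` / `add_zero_mem_of_add_five_mem` (a cell hanging from a
  hanging cell forces the other supporter);
* ★★★ `oneBlockAt_sandpile` — **for `L ≥ 2` and a pile `P`, `OneBlockAt (sandpile L P) x` at EVERY site `x`** (nine regions: the open lower half-plane by the two pattern lemmas
  `oneBlockAt_of_hanging` / `oneBlockAt_of_lower`; the rows `y = 0, 1` and the upper half-plane by the rotated pattern lemma with the base's coordinates).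

## References
* B. Bollobás, O. Riordan, *Percolation*, Cambridge University Press (2006), Ch. 7 §7.2.2 p. 168 (discrete domains: «neither `G` nor `∂⁺(G)` has a cut-vertex»).

## Mathlib / tree
Tree: `TriOneBlockPatterns` (`oneBlockAt_of_lower`, `oneBlockAt_of_hanging`, `oneBlockAt_of_four`, `oneBlockAt_of_two_off_mono`), `TriOneBlock` (`OneBlockAt`), `TriDiscShelling`
(`triDir`). Mathlib: `Finset.mem_image`, `Finset.mem_product`, `Finset.mem_range`, `omega`.
-/

noncomputable section

open Finset Literature.Probability.LatticeModels

namespace Literature.Probability.Percolation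

namespace Sandpile

/-! ### Coordinates of the six directions -/

/-- the coordinates of the six directions. [cite: BollobasRiordan2006, Ch. 7 §7.2.2 p. 168; lane plumbing] -/
theorem triDir_apply :
    triDir 0 0 = 1 ∧ triDir 0 1 = 0 ∧ triDir 1 0 = 0 ∧ triDir 1 1 = 1 ∧ triDir 2 0 = -1 ∧ triDir 2 1 = 1 ∧
      triDir 3 0 = -1 ∧ triDir 3 1 = 0 ∧ triDir 4 0 = 0 ∧ triDir 4 1 = -1 ∧ triDir 5 0 = 1 ∧ triDir 5 1 = -1 := by
  simp [triDir]

/-- `e₄ + e₁ = 0`, `e₅ + e₂ = 0`, `e₀ + e₂ = e₁`, `e₃ + e₁ = e₂`, `e₄ + e₂ = e₃`, `e₅ + e₁ = e₀` (lattice triangles). [cite: BollobasRiordan2006, Ch. 7 §7.2.2 p. 168; lane plumbing] -/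
theorem triDir_sums (x : Site 2) :
    x + triDir 4 + triDir 1 = x ∧ x + triDir 5 + triDir 2 = x ∧ x + triDir 0 + triDir 2 = x + triDir 1 ∧ x + triDir 3 + triDir 1 = x + triDir 2 ∧
      x + triDir 4 + triDir 2 = x + triDir 3 ∧ x + triDir 5 + triDir 1 = x + triDir 0 := by
  refine ⟨?_, ?_, ?_, ?_, ?_, ?_⟩ <;> (ext i; fin_cases i <;> simp [triDir])

/-! ### The base strip and piles -/

/-- **the two-row base strip** `{(x, y) : 0 ≤ x < L, y ∈ {0,1}}`. [cite: BollobasRiordan2006, Ch. 7 §7.2.2 p. 168] -/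
def baseStrip (L : ℕ) : Finset (Site 2) := ((Finset.range L) ×ˢ (Finset.range 2)).image fun p => ![(p.1 : ℤ), (p.2 : ℤ)]

/-- membership in the base strip by coordinates. [cite: BollobasRiordan2006, Ch. 7 §7.2.2 p. 168; lane plumbing] -/
theorem mem_baseStrip {L : ℕ} {x : Site 2} : x ∈ baseStrip L ↔ 0 ≤ x 0 ∧ x 0 < L ∧ 0 ≤ x 1 ∧ x 1 < 2 := by
  unfold baseStrip
  rw [Finset.mem_image]
  constructor
  · rintro ⟨⟨a, b⟩, hab, rfl⟩
    rw [Finset.mem_product, Finset.mem_range, Finset.mem_range] at hab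
    simp only [Matrix.cons_val_zero, Matrix.cons_val_one]
    omega
  · rintro ⟨h0, h1, h2, h3⟩
    refine ⟨((x 0).toNat, (x 1).toNat), ?_, ?_⟩
    · rw [Finset.mem_product, Finset.mem_range, Finset.mem_range]; omega
    · ext i; fin_cases i <;> simp <;> omega

/-- **a pile hanging below the base**: every cell has negative height and its two supporters `c + e₁`, `c + e₂` lie in the base or in the pile.
[cite: BollobasRiordan2006, Ch. 7 §7.2.2 p. 168; lane plumbing] -/
structure IsPile (L : ℕ) (P : Finset (Site 2)) : Prop where
  /-- cells hang below height `0` -/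
  below : ∀ c ∈ P, c 1 < 0
  /-- the right supporter -/
  sup₁ : ∀ c ∈ P, c + triDir 1 ∈ baseStrip L ∪ P
  /-- the left supporter -/
  sup₂ : ∀ c ∈ P, c + triDir 2 ∈ baseStrip L ∪ P

/-- **the sandpile**: base strip plus pile. [cite: BollobasRiordan2006, Ch. 7 §7.2.2 p. 168; lane plumbing] -/
def sandpile (L : ℕ) (P : Finset (Site 2)) : Finset (Site 2) := baseStrip L ∪ P

/-- membership in the sandpile, unfolded. [cite: BollobasRiordan2006, Ch. 7 §7.2.2 p. 168; lane plumbing] -/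
theorem mem_sandpile {L : ℕ} {P : Finset (Site 2)} {x : Site 2} : x ∈ sandpile L P ↔ x ∈ baseStrip L ∨ x ∈ P := Finset.mem_union

variable {L : ℕ} {P : Finset (Site 2)} (hP : IsPile L P)
include hP

omit hP in
/-- below height `0` the sandpile is the pile. [cite: BollobasRiordan2006, Ch. 7 §7.2.2 p. 168; lane plumbing] -/
theorem mem_sandpile_of_neg {x : Site 2} (hx : x 1 < 0) : x ∈ sandpile L P ↔ x ∈ P := by
  unfold sandpile
  rw [Finset.mem_union, mem_baseStrip]
  constructor
  · rintro (h | h)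
    · omega
    · exact h
  · exact Or.inr

/-- a pile cell is not at height `≥ 0`. [cite: BollobasRiordan2006, Ch. 7 §7.2.2 p. 168; lane plumbing] -/
theorem not_mem_pile_of_nonneg {x : Site 2} (hx : 0 ≤ x 1) : x ∉ P := fun h => by have := hP.below x h; omega

/-! ### The support calculus -/

/-- **nothing hangs from a site outside the set** (direction `e₄`): if `x + e₄ ∈ sandpile` with `x` at height `≤ 0` then `x ∈ sandpile`.
[cite: BollobasRiordan2006, Ch. 7 §7.2.2 p. 168; lane plumbing] -/
theorem mem_of_add_four_mem {x : Site 2} (hx : x 1 ≤ 0) (h : x + triDir 4 ∈ sandpile L P) : x ∈ sandpile L P := by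
  have hy : (x + triDir 4) 1 < 0 := by simp [triDir_apply]; omega
  have hp : x + triDir 4 ∈ P := (mem_sandpile_of_neg hy).1 h
  have := hP.sup₁ _ hp
  rwa [(triDir_sums x).1] at this

/-- **nothing hangs from a site outside the set** (direction `e₅`). [cite: BollobasRiordan2006, Ch. 7 §7.2.2 p. 168; lane plumbing] -/
theorem mem_of_add_five_mem {x : Site 2} (hx : x 1 ≤ 0) (h : x + triDir 5 ∈ sandpile L P) : x ∈ sandpile L P := by
  have hy : (x + triDir 5) 1 < 0 := by simp [triDir_apply]; omega
  have hp : x + triDir 5 ∈ P := (mem_sandpile_of_neg hy).1 h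
  have := hP.sup₂ _ hp
  rwa [(triDir_sums x).2.1] at this

/-- below height `0`: a neighbour in direction `e₀` forces the one in direction `e₁` (its left supporter). [cite: BollobasRiordan2006, Ch. 7 §7.2.2 p. 168; lane plumbing] -/
theorem add_one_mem_of_add_zero_mem {x : Site 2} (hx : x 1 < 0) (h : x + triDir 0 ∈ sandpile L P) : x + triDir 1 ∈ sandpile L P := by
  have hy : (x + triDir 0) 1 < 0 := by simp [triDir_apply]; omega
  have := hP.sup₂ _ ((mem_sandpile_of_neg hy).1 h)
  rwa [(triDir_sums x).2.2.1] at this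

/-- below height `0`: a neighbour in direction `e₃` forces the one in direction `e₂` (its right supporter). [cite: BollobasRiordan2006, Ch. 7 §7.2.2 p. 168; lane plumbing] -/
theorem add_two_mem_of_add_three_mem {x : Site 2} (hx : x 1 < 0) (h : x + triDir 3 ∈ sandpile L P) : x + triDir 2 ∈ sandpile L P := by
  have hy : (x + triDir 3) 1 < 0 := by simp [triDir_apply]; omega
  have := hP.sup₁ _ ((mem_sandpile_of_neg hy).1 h)
  rwa [(triDir_sums x).2.2.2.1] at this

/-- at height `≤ 0`: a cell hanging in direction `e₄` forces the neighbour in direction `e₃` (its other supporter). [cite: BollobasRiordan2006, Ch. 7 §7.2.2 p. 168; lane plumbing] -/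
theorem add_three_mem_of_add_four_mem {x : Site 2} (hx : x 1 ≤ 0) (h : x + triDir 4 ∈ sandpile L P) : x + triDir 3 ∈ sandpile L P := by
  have hy : (x + triDir 4) 1 < 0 := by simp [triDir_apply]; omega
  have := hP.sup₂ _ ((mem_sandpile_of_neg hy).1 h)
  rwa [(triDir_sums x).2.2.2.2.1] at this

/-- at height `≤ 0`: a cell hanging in direction `e₅` forces the neighbour in direction `e₀` (its other supporter). [cite: BollobasRiordan2006, Ch. 7 §7.2.2 p. 168; lane plumbing] -/
theorem add_zero_mem_of_add_five_mem {x : Site 2} (hx : x 1 ≤ 0) (h : x + triDir 5 ∈ sandpile L P) : x + triDir 0 ∈ sandpile L P := by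
  have hy : (x + triDir 5) 1 < 0 := by simp [triDir_apply]; omega
  have := hP.sup₁ _ ((mem_sandpile_of_neg hy).1 h)
  rwa [(triDir_sums x).2.2.2.2.2] at this

/-! ### One-block patterns everywhere -/

omit hP in
/-- membership of a neighbour in the base strip, by coordinates. [cite: BollobasRiordan2006, Ch. 7 §7.2.2 p. 168; lane plumbing] -/
theorem add_triDir_mem_baseStrip_iff (x : Site 2) (j : Fin 6) :
    x + triDir j ∈ baseStrip L ↔ 0 ≤ x 0 + triDir j 0 ∧ x 0 + triDir j 0 < L ∧ 0 ≤ x 1 + triDir j 1 ∧ x 1 + triDir j 1 < 2 := by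
  rw [mem_baseStrip]; simp

/-- a neighbour at height `≥ 0` is in the sandpile iff it is in the base. [cite: BollobasRiordan2006, Ch. 7 §7.2.2 p. 168; lane plumbing] -/
theorem add_triDir_mem_iff_of_nonneg {x : Site 2} {j : Fin 6} (h : 0 ≤ x 1 + triDir j 1) :
    x + triDir j ∈ sandpile L P ↔ 0 ≤ x 0 + triDir j 0 ∧ x 0 + triDir j 0 < L ∧ 0 ≤ x 1 + triDir j 1 ∧ x 1 + triDir j 1 < 2 := by
  rw [mem_sandpile, add_triDir_mem_baseStrip_iff]
  constructor
  · rintro (hb | hp)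
    · exact hb
    · exact absurd hp (not_mem_pile_of_nonneg hP (by simpa using h))
  · exact Or.inl

/-- ★★★ **THE SANDPILE HAS ONE-BLOCK RING PATTERNS AT EVERY SITE** (`L ≥ 2`). [cite: BollobasRiordan2006, Ch. 7 §7.2.2 p. 168 («neither `G` nor `∂⁺(G)` has a cut-vertex»)] -/
theorem oneBlockAt_sandpile (hL : 2 ≤ L) (x : Site 2) : OneBlockAt (sandpile L P) x := by
  have T := triDir_apply
  obtain ⟨t00, t01, t10, t11, t20, t21, t30, t31, t40, t41, t50, t51⟩ := T
  rcases lt_or_ge (x 1) 0 with hneg | hnn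
  · -- the open lower half-plane: hanging cell or outer site below the pile
    by_cases hx : x ∈ sandpile L P
    · have hxP : x ∈ P := (mem_sandpile_of_neg hneg).1 hx
      refine oneBlockAt_of_hanging ?_ ?_ (fun h => add_three_mem_of_add_four_mem hP hneg.le h) (fun h => add_zero_mem_of_add_five_mem hP hneg.le h)
      · exact hP.sup₁ x hxP
      · exact hP.sup₂ x hxP
    · exact oneBlockAt_of_lower (fun h => hx (mem_of_add_four_mem hP hneg.le h)) (fun h => hx (mem_of_add_five_mem hP hneg.le h))
        (fun h => add_one_mem_of_add_zero_mem hP hneg h) (fun h => add_two_mem_of_add_three_mem hP hneg h)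
  · -- height ≥ 0: only the base strip and (below the row 0) hanging cells matter
    rcases lt_or_ge (x 1) 2 with hlt2 | hge2
    · rcases lt_or_ge (x 1) 1 with hlt1 | hge1
      · -- ROW y = 0
        have hy : x 1 = 0 := by omega
        rcases lt_or_ge (x 0) 0 with hxneg | hx0
        · -- left of the base: pattern ⊆ {0}; nothing hangs here
          refine oneBlockAt_of_two_off_mono 4 ?_ ?_ (fun h => ?_) (fun h => ?_)
          · show x + triDir (4 + 4) ∉ _; rw [show (4 : Fin 6) + 4 = 2 by decide, add_triDir_mem_iff_of_nonneg hP (by omega)]; omega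
          · show x + triDir (4 + 5) ∉ _; rw [show (4 : Fin 6) + 5 = 3 by decide, add_triDir_mem_iff_of_nonneg hP (by omega)]; omega
          · exfalso
            -- `x + e₄ ∈ sandpile` would force `x ∈ sandpile`, but `x` is left of the base at height 0
            have := mem_of_add_four_mem hP (by omega) h
            rw [mem_sandpile] at this
            rcases this with hb | hp
            · rw [mem_baseStrip] at hb; omega
            · exact not_mem_pile_of_nonneg hP (by omega) hp
          · show x + triDir (4 + 2) ∈ _
            rw [show (4 : Fin 6) + 3 = 1 by decide] at h
            rw [add_triDir_mem_iff_of_nonneg hP (by omega)] at h; omega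
        · rcases lt_or_ge (x 0) L with hxL | hxL
          · rcases eq_or_lt_of_le hx0 with hx00 | hxpos
            · -- bottom-left corner x 0 = 0: pattern {0,1} ∪ {5?}
              refine oneBlockAt_of_two_off_mono 4 ?_ ?_ (fun h => ?_) (fun h => ?_)
              · show x + triDir (4 + 4) ∉ _; rw [show (4 : Fin 6) + 4 = 2 by decide, add_triDir_mem_iff_of_nonneg hP (by omega)]; omega
              · show x + triDir (4 + 5) ∉ _; rw [show (4 : Fin 6) + 5 = 3 by decide, add_triDir_mem_iff_of_nonneg hP (by omega)]; omega
              · -- `x + e₄ ∈ P` would need the supporter `x + e₄ + e₂ = x + e₃`, which is left of the base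
                exfalso
                have h3 := add_three_mem_of_add_four_mem hP (by omega) h
                rw [add_triDir_mem_iff_of_nonneg hP (by omega)] at h3; omega
              · show x + triDir (4 + 2) ∈ _
                rw [show (4 : Fin 6) + 2 = 0 by decide, add_triDir_mem_iff_of_nonneg hP (by omega)]; omega
            · rcases lt_or_ge (x 0 + 1) L with hxi | hxe
              · -- interior of the bottom row: bits 0–3 on
                exact oneBlockAt_of_four ((add_triDir_mem_iff_of_nonneg hP (by omega)).2 (by omega)) ((add_triDir_mem_iff_of_nonneg hP (by omega)).2 (by omega))
                  ((add_triDir_mem_iff_of_nonneg hP (by omega)).2 (by omega)) ((add_triDir_mem_iff_of_nonneg hP (by omega)).2 (by omega))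
              · -- bottom-right corner x 0 = L - 1: pattern {1,2,3} ∪ {4?}
                refine oneBlockAt_of_two_off_mono 1 ?_ ?_ (fun h => ?_) (fun h => ?_)
                · -- `x + e₅` would need the supporter `x + e₅ + e₁ = x + e₀ = (L, 0)` in the set
                  show x + triDir (1 + 4) ∉ _
                  rw [show (1 : Fin 6) + 4 = 5 by decide]
                  intro h5
                  have h0 := add_zero_mem_of_add_five_mem hP (by omega) h5
                  rw [add_triDir_mem_iff_of_nonneg hP (by omega)] at h0; omega
                · show x + triDir (1 + 5) ∉ _; rw [show (1 : Fin 6) + 5 = 0 by decide, add_triDir_mem_iff_of_nonneg hP (by omega)]; omega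
                · show x + triDir (1 + 1) ∈ _; rw [show (1 : Fin 6) + 1 = 2 by decide, add_triDir_mem_iff_of_nonneg hP (by omega)]; omega
                · show x + triDir (1 + 2) ∈ _; rw [show (1 : Fin 6) + 2 = 3 by decide, add_triDir_mem_iff_of_nonneg hP (by omega)]; omega
          · -- right of the base at height 0: pattern ⊆ {2,3}
            refine oneBlockAt_of_two_off_mono 1 ?_ ?_ (fun h => ?_) (fun h => ?_)
            · show x + triDir (1 + 4) ∉ _
              rw [show (1 : Fin 6) + 4 = 5 by decide]
              intro h5
              have h0 := add_zero_mem_of_add_five_mem hP (by omega) h5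
              rw [add_triDir_mem_iff_of_nonneg hP (by omega)] at h0; omega
            · show x + triDir (1 + 5) ∉ _; rw [show (1 : Fin 6) + 5 = 0 by decide, add_triDir_mem_iff_of_nonneg hP (by omega)]; omega
            · exfalso; rw [add_triDir_mem_iff_of_nonneg hP (by omega)] at h; omega
            · exfalso
              rw [show (1 : Fin 6) + 3 = 4 by decide] at h
              have := mem_of_add_four_mem hP (by omega) h
              rw [mem_sandpile, mem_baseStrip] at this
              rcases this with hb | hp
              · omega
              · exact not_mem_pile_of_nonneg hP (by omega) hp
      · -- ROW y = 1: pattern ⊆ {3,4,5,0}, bits 1, 2 off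
        have hy : x 1 = 1 := by omega
        rcases lt_or_ge (x 0) 0 with hxneg | hx0
        · refine oneBlockAt_of_two_off_mono 4 ?_ ?_ (fun h => ?_) (fun h => ?_)
          · show x + triDir (4 + 4) ∉ _; rw [show (4 : Fin 6) + 4 = 2 by decide, add_triDir_mem_iff_of_nonneg hP (by omega)]; omega
          · show x + triDir (4 + 5) ∉ _; rw [show (4 : Fin 6) + 5 = 3 by decide, add_triDir_mem_iff_of_nonneg hP (by omega)]; omega
          · exfalso; rw [add_triDir_mem_iff_of_nonneg hP (by omega)] at h; omega
          · exfalso; rw [show (4 : Fin 6) + 3 = 1 by decide, add_triDir_mem_iff_of_nonneg hP (by omega)] at h; omega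
        · rcases lt_or_ge (x 0) L with hxL | hxL
          · refine oneBlockAt_of_two_off_mono 3 ?_ ?_ (fun h => ?_) (fun h => ?_)
            · show x + triDir (3 + 4) ∉ _; rw [show (3 : Fin 6) + 4 = 1 by decide, add_triDir_mem_iff_of_nonneg hP (by omega)]; omega
            · show x + triDir (3 + 5) ∉ _; rw [show (3 : Fin 6) + 5 = 2 by decide, add_triDir_mem_iff_of_nonneg hP (by omega)]; omega
            · show x + triDir (3 + 1) ∈ _
              rw [show (3 : Fin 6) + 1 = 4 by decide, add_triDir_mem_iff_of_nonneg hP (by omega)]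
              rw [add_triDir_mem_iff_of_nonneg hP (by omega)] at h; omega
            · show x + triDir (3 + 2) ∈ _
              rw [show (3 : Fin 6) + 3 = 0 by decide] at h
              rw [show (3 : Fin 6) + 2 = 5 by decide, add_triDir_mem_iff_of_nonneg hP (by omega)]
              rw [add_triDir_mem_iff_of_nonneg hP (by omega)] at h; omega
          · refine oneBlockAt_of_two_off_mono 2 ?_ ?_ (fun h => ?_) (fun h => ?_)
            · show x + triDir (2 + 4) ∉ _; rw [show (2 : Fin 6) + 4 = 0 by decide, add_triDir_mem_iff_of_nonneg hP (by omega)]; omega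
            · show x + triDir (2 + 5) ∉ _; rw [show (2 : Fin 6) + 5 = 1 by decide, add_triDir_mem_iff_of_nonneg hP (by omega)]; omega
            · exfalso; rw [add_triDir_mem_iff_of_nonneg hP (by omega)] at h; omega
            · exfalso; rw [show (2 : Fin 6) + 3 = 5 by decide, add_triDir_mem_iff_of_nonneg hP (by omega)] at h; omega
    · -- height ≥ 2: pattern ⊆ {4, 5}
      refine oneBlockAt_of_two_off_mono 3 ?_ ?_ (fun h => ?_) (fun h => ?_)
      · show x + triDir (3 + 4) ∉ _; rw [show (3 : Fin 6) + 4 = 1 by decide, add_triDir_mem_iff_of_nonneg hP (by omega)]; omega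
      · show x + triDir (3 + 5) ∉ _; rw [show (3 : Fin 6) + 5 = 2 by decide, add_triDir_mem_iff_of_nonneg hP (by omega)]; omega
      · exfalso; rw [add_triDir_mem_iff_of_nonneg hP (by omega)] at h; omega
      · exfalso; rw [show (3 : Fin 6) + 3 = 0 by decide, add_triDir_mem_iff_of_nonneg hP (by omega)] at h; omega

/-! ### The class: the bare strip, and closure under attaching a supported cell -/

omit hP in
/-- **the bare base strip is a sandpile** (empty pile). [cite: BollobasRiordan2006, Ch. 7 §7.2.2 p. 168; lane plumbing] -/
theorem IsPile.empty (L : ℕ) : IsPile L ∅ :=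
  ⟨fun _ h => absurd h (Finset.notMem_empty _), fun _ h => absurd h (Finset.notMem_empty _), fun _ h => absurd h (Finset.notMem_empty _)⟩

/-- ★ **the class is closed under attaching a supported cell**: a cell of negative height whose two supporters lie in the sandpile may be added to the pile.
[cite: BollobasRiordan2006, Ch. 7 §7.2.2 p. 168; lane plumbing] -/
theorem IsPile.attach {e : Site 2} (he : e 1 < 0) (h1 : e + triDir 1 ∈ sandpile L P) (h2 : e + triDir 2 ∈ sandpile L P) : IsPile L (insert e P) := by
  classical
  have grow : ∀ {z : Site 2}, z ∈ sandpile L P → z ∈ baseStrip L ∪ insert e P := fun hz => by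
    rcases Finset.mem_union.1 hz with hb | hp
    · exact Finset.mem_union.2 (Or.inl hb)
    · exact Finset.mem_union.2 (Or.inr (Finset.mem_insert_of_mem hp))
  refine ⟨fun c hc => ?_, fun c hc => ?_, fun c hc => ?_⟩
  · rcases Finset.mem_insert.1 hc with rfl | hc
    · exact he
    · exact hP.below c hc
  · rcases Finset.mem_insert.1 hc with rfl | hc
    · exact grow h1
    · exact grow (hP.sup₁ c hc)
  · rcases Finset.mem_insert.1 hc with rfl | hc
    · exact grow h2
    · exact grow (hP.sup₂ c hc)

omit hP in
/-- the sandpile grows by the attached cell. [cite: BollobasRiordan2006, Ch. 7 §7.2.2 p. 168; lane plumbing] -/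
theorem sandpile_insert (e : Site 2) : sandpile L (insert e P) = insert e (sandpile L P) := by
  classical
  unfold sandpile
  rw [Finset.union_insert]

end Sandpile

end Literature.Probability.Percolation
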